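import Literature.NumberTheory.FaltingsSerre.Paramodular461
import Literature.NumberTheory.FaltingsSerre.CriterionProofs
import HarnessLib

/-!
# `A₄₆₁` is paramodular of level `461` away from `461`, from the frozen certificate — criterion discharged

[BPPTVY] = A. Brumer, A. Pacetti, C. Poor, G. Tornaría, J. Voight, D. S. Yuen, *On the paramodularity of
typical abelian surfaces*, Algebra & Number Theory **13**:5 (2019) 1145–1195 [cite: BrumerEtAl2019]
(§7 treats `N = 277, 353, 587` only; level `461` is not in print as an instance — cell FRESHNESS.md,
FRESHNESS-349.md: "not in print as of 2026-08-20", never claimed 'first').  [PY15] = C. Poor, D. S. Yuen,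
*Paramodular cusp forms*, Math. Comp. **84** (2015) 1401–1438 [cite: PoorYuen2015]: Thm 1.2 (p. 1402;
outside `{277, 349, 353, 389, 461, 523, 587}` every weight-2 paramodular cusp form of prime level `< 600` is a
Gritsenko lift) and Table 5 (p. 1433: column `461`, `λ₂ = 0`, `λ₃ = −3`, `λ₄ = −3`, `λ₅ = 1`, `λ₇ = 0`,
`λ₉ = 2`, `λ₁₁ = 2`); [PSY20] = C. Poor, J. Shurman, D. S. Yuen, *Nonlift weight two paramodular eigenform
constructions*, J. Korean Math. Soc. **57** (2020), no. 2, 507–522 [cite: PoorShurmanYuen2020]: Thm 1.1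
(p. 508: `dim J^cusp_{2,461} = 12`, `dim S₂(K(461))⁺ = 13`, `dim S₂(K(461))⁻ = 0` — with [PY15, §7 p. 1432:
"at most one nonlift in each S₂(K(p))"] this is existence and uniqueness of the nonlift eigenform `f₄₆₁`),
Thm 1.2 (p. 509: "The conjectured nonlift eigenform formulas `f_N = Q_N/L_N` of [PY15] and its website are
correct for `N = 349, 353, 389, 461, 523, 587±`", proof §6 pp. 520–521 — the formula the cell's first
implementation specializes, website file `QL-461.txt`), §5 (pp. 519–520: no nonlift Borcherds product in
`S₂(K(461))⁺`; the nonlift is traced down from a polarized Borcherds product in `S₂(K(922))⁻`).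

`Literature.NumberTheory.FaltingsSerre.Paramodular461.paramodular_461` (p215036, instance of
`ParamodularTemplate.lean` for the frozen certificate `certs/461/certificate.canonical.json`, sha256
`8ab3284b29ac0abe4aa6ce757e360b9c92c6673cf94300f080720087b6dbe5e3`) carries the hypothesis
`hFS : traceEq_of_faltingsSerre_symplectic` (the Faltings–Serre criterion [BPPTVY, Thm. 2.1.5 p. 1150 /
Alg. 2.4.1 p. 1155] as a named statement).  That statement is PROVED in the tree
(`Literature.NumberTheory.FaltingsSerre.traceEq_of_faltingsSerre_symplectic_holds`, `CriterionProofs.lean`,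
p181742), so — exactly as `ParamodularUnconditional.paramodular_277_holds` (N = 277),
`Paramodular349.paramodular_349_holds` (N = 349), `Paramodular353.paramodular_353_holds` and
`Paramodular587plus.paramodular_587plus_holds` do — this file restates `paramodular_461` WITHOUT `hFS`.
Remaining binders: the certificate `hC` (discharged outside the kernel, every load-bearing datum by two
independent implementations — image `S₅(b)`, `K₀` of degree 10, `4095` quadratic extensions, check primes
`{3,5,7,11,13,17,19,23,29,31,67}`; REFEREE.md R102 / ruling S-g105: `a₆₇(f₄₆₁) = 5` by the impl-A `e =
4` union of 16/16 `T(67)` shift-chunks = engine C = the referee’s own fold = `a₆₇(A₄₆₁)`; freeze audit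
A1–A10 = Audit 150, queued at the time of writing), the `A`-side frame/Euler data, the cited `ρ_{f,2}`
of [BPPTVY, Thm. 4.3.4 p. 1169] (`hρf`, Arthur-dependent via Mok, bib `Mok2014Compositio`), the form data,
and the hand check at `p = 2` (`a₂ = 0`, `b₂ = 2` both sides: `L₂ = Q₂ = 1 + 2T² + 4T⁴`; [PY15] Table 5
`λ₂ = 0`, `λ₄ = −3`).

Provenance of the curve (DATA): `C₄₆₁ : y² + x³y = x⁵ − 3x³ + 3x − 2` is the LMFDB minimal model
`461.a.461.1` (`g2c_curves`; the certificate's model `Q = [0,0,0,1]`, `P = [-2,3,0,-3,0,1]`;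
Brumer–Kramer's conductor-461 surface: `y² = 4P + Q² = x⁶+4x⁵−12x³+12x−8` becomes, under `x ↦ −x−1`,
the PRINTED row "461: x⁶+2x⁵−5x⁴−8x³+11x²+10x−11, INFO q" of [BK14, Table 2 p. 2512] = A. Brumer, K. Kramer,
*Paramodular abelian varieties of odd conductor*, Trans. Amer. Math. Soc. **366** (2014) 2463–2516
[cite: BrumerKramer2014], "q" = irreducible symplectic `A[2]` with `Gal ≅ S₅` and quintic stem field
(Notation A.1 p. 2510); the class is the unique one of conductor 461 by [BK18, Thm 1.3]); conductor and every Euler factor used were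
RECOMPUTED twice by the cell (certs/461/galois, certs/461 curve registers; kernel-decided point counts in
`KernelCounts461.lean`, p190232).  HONEST FRAMING: the method is [BPPTVY]'s; this level-`461` pairing is
certified by a published method and is not in print as of 2026-08-20 — never claimed 'first'.
-/

noncomputable section

namespace Literature.NumberTheory.FaltingsSerre.Paramodular461

open Polynomial IsDedekindDomain
open Literature.NumberTheory.FaltingsSerre Literature.NumberTheory.GaloisRepresentations
  Literature.NumberTheory.Automorphic.Paramodular Literature.NumberTheory.Automorphic
  Literature.AlgebraicGeometry.Motives
open scoped NumberField

/-- **`A₄₆₁ = Jac(C₄₆₁)` is paramodular of level `461` away from `461`, with partner `f₄₆₁` — criterion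
discharged**: the statement of `paramodular_461` without `hFS`, supplied by
`traceEq_of_faltingsSerre_symplectic_holds` ([BPPTVY, Thm. 2.1.5 p. 1150 / Alg. 2.4.1 p. 1155], proved in
`CriterionProofs.lean`). [cite: BrumerEtAl2019, Thm 2.1.5 p. 1150; Alg 2.4.1 p. 1155; Thm 4.3.4 p. 1169; PoorYuen2015, Table 5 p. 1433; PoorShurmanYuen2020, Thm 1.1 p. 508, Thm 1.2 p. 509] -/
theorem paramodular_461_holds
    {A : AbelianVariety ℚ} {f : Matrix (Fin 2) (Fin 2) ℂ → ℂ}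
    {ρA ρf : FramedGaloisRep ℚ ℤ_[2] 4} {J : Matrix (Fin 4) (Fin 4) ℤ_[2]}
    {ν : Field.absoluteGaloisGroup ℚ → ℤ_[2]}
    {b : Module.Basis (Fin 4) ℚ_[2] (A.rationalTateModule 2)}
    (hC : Certificate461 J ν ρA ρf)
    (hframe : A.IsFrameOfTateRep 2 b (rationalize ρA))
    (aA bA af bf : ℕ → ℤ)
    (hA : ∀ p : ℕ, p.Prime → ¬ p ∣ 461 →
      A.HasGoodEulerFactorAt p ((lPolynomialOfSurface p (aA p) (bA p)).map (Int.castRingHom ℚ)))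
    (hρf : ∀ p : ℕ, p.Prime → ¬ p ∣ 461 → p ≠ 2 →
      ∀ v : HeightOneSpectrum (𝓞 ℚ), ((p : ℕ) : 𝓞 ℚ) ∈ v.asIdeal →
        ρf.HasFrobCharpolyAt v
          ((lPolynomialOfSurface p (af p) (bf p)).reverse.map (Int.castRingHom ℤ_[2])))
    (hcusp : IsParamodularCuspForm 461 2 f) (hne : ∃ Z ∈ siegelUpperHalfSpace 2, f Z ≠ 0)
    (hfe : ∀ p : ℕ, p.Prime → ¬ p ∣ 461 →
      HasSpinorEulerFactorAt 2 p f ((lPolynomialOfSurface p (af p) (bf p)).map (Int.castRingHom ℂ)))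
    (h2 : aA 2 = af 2 ∧ bA 2 = bf 2) :
    IsParamodularAwayFrom A 461 f :=
  paramodular_461 traceEq_of_faltingsSerre_symplectic_holds hC hframe aA bA af bf hA hρf hcusp hne
    hfe h2

/-- The unconditional conclusion at one prime `p ≠ 461`: one polynomial is both `L_p(A₄₆₁,T)` and
`Q_p(f₄₆₁,T)`. [cite: BrumerEtAl2019, Thm 7.1.3 p. 1187 (shape of the statement)] -/
theorem eulerFactors_agree_461_holds
    {A : AbelianVariety ℚ} {f : Matrix (Fin 2) (Fin 2) ℂ → ℂ}
    {ρA ρf : FramedGaloisRep ℚ ℤ_[2] 4} {J : Matrix (Fin 4) (Fin 4) ℤ_[2]}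
    {ν : Field.absoluteGaloisGroup ℚ → ℤ_[2]}
    {b : Module.Basis (Fin 4) ℚ_[2] (A.rationalTateModule 2)}
    (hC : Certificate461 J ν ρA ρf)
    (hframe : A.IsFrameOfTateRep 2 b (rationalize ρA))
    (aA bA af bf : ℕ → ℤ)
    (hA : ∀ p : ℕ, p.Prime → ¬ p ∣ 461 →
      A.HasGoodEulerFactorAt p ((lPolynomialOfSurface p (aA p) (bA p)).map (Int.castRingHom ℚ)))
    (hρf : ∀ p : ℕ, p.Prime → ¬ p ∣ 461 → p ≠ 2 →
      ∀ v : HeightOneSpectrum (𝓞 ℚ), ((p : ℕ) : 𝓞 ℚ) ∈ v.asIdeal →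
        ρf.HasFrobCharpolyAt v
          ((lPolynomialOfSurface p (af p) (bf p)).reverse.map (Int.castRingHom ℤ_[2])))
    (hcusp : IsParamodularCuspForm 461 2 f) (hne : ∃ Z ∈ siegelUpperHalfSpace 2, f Z ≠ 0)
    (hfe : ∀ p : ℕ, p.Prime → ¬ p ∣ 461 →
      HasSpinorEulerFactorAt 2 p f ((lPolynomialOfSurface p (af p) (bf p)).map (Int.castRingHom ℂ)))
    (h2 : aA 2 = af 2 ∧ bA 2 = bf 2) {p : ℕ} (hp : p.Prime) (hpN : p ≠ 461) :
    ∃ Q : Polynomial ℚ, HasSpinorEulerFactorAt 2 p f (Q.map (algebraMap ℚ ℂ)) ∧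
      A.HasGoodEulerFactorAt p Q :=
  eulerFactors_agree_461 (paramodular_461_holds hC hframe aA bA af bf hA hρf hcusp hne hfe h2)
    hp hpN

end Literature.NumberTheory.FaltingsSerre.Paramodular461

end
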